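import Mathlib.NumberTheory.Padics.Hensel
import Mathlib.Data.Nat.Choose.Dvd
import Mathlib.NumberTheory.Padics.RingHoms
import Mathlib.FieldTheory.Finite.Basic
import HarnessLib

/-!
# `p`-th powers in `ℤ_pˣ` for odd `p`: `u` is a `p`-th power iff `u^{p−1} ≡ 1 (mod p²)`
# (Serre, *A Course in Arithmetic*, Ch. II §3)

Source: J.-P. Serre, *A Course in Arithmetic*, GTM 7 (1973) [Serre1973], Ch. II §3.1–3.3: the group
of units `U = ℤ_pˣ` is `V × U₁` with `V = {x : x^{p−1} = 1}` (Prop. 7 / Thm. 3 proof) and, for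
`p ≠ 2`, `U₁ = 1 + pℤ_p` is a free `ℤ_p`-module of rank one generated by `1 + p`, the filtration
`U_n = 1 + pⁿℤ_p` satisfying `(U_n)^p = U_{n+1}` for `n ≥ 1` (Lemma and Prop. 8 of §3.2:
"if `p ≠ 2` … `x ∈ U_n − U_{n+1}` ⟹ `x^p ∈ U_{n+1} − U_{n+2}`"). Consequently, for `p` odd,

> a unit `u ∈ ℤ_pˣ` is a `p`-th power in `ℤ_p` iff its projection to `U₁` lies in `U₂`,
> i.e. iff `u^{p−1} ≡ 1 (mod p²)`.

THIS FILE proves that criterion for Mathlib's `ℤ_[p]` (theorems only; 0 definitions, 0 named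
facts), elementarily: `U₂ ⊆ (ℤ_p)^p` by Hensel's lemma (Mathlib `hensels_lemma`) applied to
`X^p − u` at the approximate root `a = 1 + p·t` for `u = 1 + p²·t` (`(1 + pt)^p ≡ 1 + p²t (mod p³)`
because `p ∣ binom(p, 2)` for odd `p`), then `u = u^p / u^{p−1}`; the converse from Fermat's little
theorem `x^{p−1} ≡ 1 (mod p)` and `(1 + p s)^p ≡ 1 (mod p²)`.

Consumer (why it is here): the BSD-DENSITY sprint's 5-adic seam (cell book
`cells/density/C0-SPEC.md`, G9): the tree's `prime_torsion_ne_zero_iff_exists_pow_eq_tateParameter`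
(Tate uniformisation: `E(ℚ_p)[p] ≠ 0 ⟺ ∃ u, u^p = q_E`) must be turned into a CONGRUENCE on `q_E`
— at `p = 5`: `q_E ∈ (ℚ₅ˣ)⁵ ⟺ 5 ∣ ord₅ q_E ∧ (q_E/5^k)⁴ ≡ 1 (mod 25)` (the four fourth roots of
unity `±1, ±7 (mod 25)`, bundle Lemma 4.3 / `Densities.fifthPowers_mod25`). This file supplies the
unit part of that equivalence for every odd `p`; the valuation part is `p ∣ ord_p`.

Namespacing (`CONVENTIONS.md` §2: "never declare into Mathlib's namespaces except deliberate
dot-notation extensions, and say so in the docstring"): the five public theorems below are DELIBERATE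
dot-notation extensions declared in Mathlib's root namespaces `PadicInt` (four, on `ℤ_[p]`) and
`Padic` (one, on `ℚ_[p]`); nothing else is added to those namespaces, and the file's `private`
helpers live there only for the duration of the `namespace … end` blocks.

Contents:
* `PadicInt.exists_pow_prime_eq_of_sq_dvd_sub_one` — `p² ∣ u − 1 ⟹ ∃ x, x^p = u` (`p` odd);
* `PadicInt.sq_dvd_pow_sub_one_sub_one_of_pow_eq` — `x^p = u`, `u` a unit ⟹ `p² ∣ u^{p−1} − 1`;
* `PadicInt.exists_pow_prime_eq_iff` — **for `p` odd and `u ∈ ℤ_[p]` a unit: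
  `(∃ x, x^p = u) ↔ (p : ℤ_[p])² ∣ u^{p−1} − 1`**;
* `PadicInt.exists_pow_prime_eq_of_sq_dvd_sub_one'` — its `⇐` direction as a standalone statement
  (`p² ∣ u^{p−1} − 1 ⟹ ∃ x, x^p = u`);
* `Padic.exists_pow_prime_eq_iff_of_eq_pow_mul` — for `q = p^k · u ∈ ℚ_[p]`, `u` a unit:
  `(∃ x : ℚ_[p], x^p = q) ↔ p ∣ k ∧ p² ∣ u^{p−1} − 1`.
-/

noncomputable section

open Polynomial

namespace PadicInt

variable {p : ℕ} [hp : Fact p.Prime]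

/-! ### Norm bookkeeping -/

/-- `‖y‖ ≤ p^{-n}` for `pⁿ ∣ y` in `ℤ_[p]`. [folklore] -/
private theorem norm_le_of_pow_dvd {y : ℤ_[p]} {n : ℕ} (h : (p : ℤ_[p]) ^ n ∣ y) :
    ‖y‖ ≤ (p : ℝ)⁻¹ ^ n := by
  obtain ⟨z, rfl⟩ := h
  rw [norm_mul, norm_pow, norm_p]
  exact mul_le_of_le_one_right (pow_nonneg (inv_nonneg.mpr (Nat.cast_nonneg _)) _) (norm_le_one z)

/-- A unit times `p` has norm `< 1`, so `1 + p t` is a unit of norm `1`. [folklore] -/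
private theorem norm_one_add_p_mul (t : ℤ_[p]) : ‖1 + (p : ℤ_[p]) * t‖ = 1 := by
  have hlt : ‖(p : ℤ_[p]) * t‖ < 1 := by
    rw [norm_mul, norm_p]
    have hp1 : (1 : ℝ) < p := by exact_mod_cast hp.out.one_lt
    calc (p : ℝ)⁻¹ * ‖t‖ ≤ (p : ℝ)⁻¹ * 1 :=
          mul_le_mul_of_nonneg_left (norm_le_one t) (inv_nonneg.mpr (Nat.cast_nonneg _))
      _ < 1 := by rw [mul_one]; exact inv_lt_one_of_one_lt₀ hp1
  have h := norm_add_eq_max_of_ne (q := (1 : ℤ_[p])) (r := (p : ℤ_[p]) * t)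
    (by rw [norm_one]; exact hlt.ne')
  rw [h, norm_one, max_eq_left hlt.le]

/-! ### `U₂ ⊆ (ℤ_p)^p` by Hensel -/

/-- `(1 + p t)^p − (1 + p² t)` is divisible by `p³` for `p` odd (`p ∣ binom(p,2)`). [folklore] -/
private theorem pow_three_dvd_one_add_pow_sub (hp2 : p ≠ 2) (t : ℤ_[p]) :
    (p : ℤ_[p]) ^ 3 ∣ (1 + (p : ℤ_[p]) * t) ^ p - (1 + (p : ℤ_[p]) ^ 2 * t) := by
  have hp3 : 3 ≤ p := by
    have := hp.out.two_le
    omega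
  -- binomial expansion: `(pt + 1)^p = ∑_{k ≤ p} (pt)^k · binom(p,k)`
  have hexp : (1 + (p : ℤ_[p]) * t) ^ p =
      ∑ k ∈ Finset.range (p + 1), ((p : ℤ_[p]) * t) ^ k * (p.choose k : ℤ_[p]) := by
    rw [add_comm, add_pow]
    simp only [one_pow, mul_one]
  -- split off `k = 0, 1`
  have hsplit : ∑ k ∈ Finset.range (p + 1), ((p : ℤ_[p]) * t) ^ k * (p.choose k : ℤ_[p]) =
      1 + (p : ℤ_[p]) ^ 2 * t +
        ∑ k ∈ Finset.Ico 2 (p + 1), ((p : ℤ_[p]) * t) ^ k * (p.choose k : ℤ_[p]) := by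
    rw [Finset.range_eq_Ico, ← Finset.sum_Ico_consecutive _ (show 0 ≤ 2 by omega) (by omega)]
    congr 1
    rw [Nat.Ico_zero_eq_range, Finset.sum_range_succ, Finset.sum_range_succ, Finset.sum_range_zero]
    simp [Nat.choose_one_right]
    ring
  rw [hexp, hsplit, add_sub_cancel_left]
  refine Finset.dvd_sum fun k hk ↦ ?_
  rw [Finset.mem_Ico] at hk
  rcases Nat.lt_or_ge k 3 with hk3 | hk3
  · -- `k = 2`: `p ∣ binom(p, 2)`
    have hk2 : k = 2 := by omega
    subst hk2
    have hdvd : p ∣ p.choose 2 := Nat.Prime.dvd_choose_self hp.out (by norm_num) (by omega)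
    obtain ⟨c, hc⟩ := hdvd
    refine ⟨t ^ 2 * c, ?_⟩
    rw [hc]; push_cast; ring
  · -- `k ≥ 3`: `p^k` has `p³`
    obtain ⟨j, rfl⟩ := Nat.exists_eq_add_of_le hk3
    refine ⟨(p : ℤ_[p]) ^ j * t ^ (3 + j) * (p.choose (3 + j) : ℤ_[p]), ?_⟩
    ring

/-- **`1 + p²ℤ_p ⊆ (ℤ_p)^p` for odd `p`** (Serre II §3.2, Lemma / Prop. 8: `U₂ = U₁^p`): if
`p² ∣ u − 1` then `u = x^p` for some `x ∈ ℤ_[p]`, by Hensel's lemma for `X^p − u` at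
`a = 1 + p t`, `u = 1 + p² t`. [cite: Serre1973, Ch. II §3.2, Lemma and Prop. 8] -/
theorem exists_pow_prime_eq_of_sq_dvd_sub_one (hp2 : p ≠ 2) {u : ℤ_[p]}
    (hu : (p : ℤ_[p]) ^ 2 ∣ u - 1) : ∃ x : ℤ_[p], x ^ p = u := by
  obtain ⟨t, ht⟩ := hu
  have hu' : u = 1 + (p : ℤ_[p]) ^ 2 * t := by linear_combination ht
  set a : ℤ_[p] := 1 + (p : ℤ_[p]) * t with ha
  set F : Polynomial ℤ_[p] := X ^ p - C u with hF
  have hFa : F.aeval a = a ^ p - u := by simp [hF]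
  have hF' : F.derivative.aeval a = (p : ℤ_[p]) * a ^ (p - 1) := by
    simp [hF, derivative_X_pow]
  have ha1 : ‖a‖ = 1 := norm_one_add_p_mul t
  have hp0 : (0 : ℝ) < p := by exact_mod_cast hp.out.pos
  have hnF' : ‖F.derivative.aeval a‖ = (p : ℝ)⁻¹ := by
    rw [hF', norm_mul, norm_pow, ha1, one_pow, mul_one, norm_p]
  have hnF : ‖F.aeval a‖ ≤ (p : ℝ)⁻¹ ^ 3 := by
    rw [hFa, hu', ha]
    exact norm_le_of_pow_dvd (pow_three_dvd_one_add_pow_sub hp2 t)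
  have hnorm : ‖F.aeval a‖ < ‖F.derivative.aeval a‖ ^ 2 := by
    rw [hnF']
    refine hnF.trans_lt ?_
    have hlt : (p : ℝ)⁻¹ < 1 := inv_lt_one_of_one_lt₀ (by exact_mod_cast hp.out.one_lt)
    have hpos : (0 : ℝ) < (p : ℝ)⁻¹ := inv_pos.mpr hp0
    calc (p : ℝ)⁻¹ ^ 3 = (p : ℝ)⁻¹ ^ 2 * (p : ℝ)⁻¹ := by ring
      _ < (p : ℝ)⁻¹ ^ 2 * 1 := mul_lt_mul_of_pos_left hlt (by positivity)
      _ = (p : ℝ)⁻¹ ^ 2 := mul_one _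
  obtain ⟨z, hz, -, -, -⟩ := hensels_lemma hnorm
  refine ⟨z, ?_⟩
  have : z ^ p - u = 0 := by simpa [hF] using hz
  linear_combination this

/-! ### The converse: `x^p = u` forces `u^{p−1} ∈ U₂` -/

/-- `(1 + p s)^p − 1` is divisible by `p²`. [folklore] -/
private theorem sq_dvd_one_add_pow_sub_one (s : ℤ_[p]) :
    (p : ℤ_[p]) ^ 2 ∣ (1 + (p : ℤ_[p]) * s) ^ p - 1 := by
  have hexp : (1 + (p : ℤ_[p]) * s) ^ p =
      ∑ k ∈ Finset.range (p + 1), ((p : ℤ_[p]) * s) ^ k * (p.choose k : ℤ_[p]) := by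
    rw [add_comm, add_pow]
    simp only [one_pow, mul_one]
  have hsplit : ∑ k ∈ Finset.range (p + 1), ((p : ℤ_[p]) * s) ^ k * (p.choose k : ℤ_[p]) =
      1 + ∑ k ∈ Finset.Ico 1 (p + 1), ((p : ℤ_[p]) * s) ^ k * (p.choose k : ℤ_[p]) := by
    rw [Finset.range_eq_Ico, ← Finset.sum_Ico_consecutive _ (show 0 ≤ 1 by omega) (by omega)]
    congr 1
    rw [Nat.Ico_zero_eq_range, Finset.sum_range_succ, Finset.sum_range_zero]
    simp
  rw [hexp, hsplit, add_sub_cancel_left]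
  refine Finset.dvd_sum fun k hk ↦ ?_
  rw [Finset.mem_Ico] at hk
  rcases Nat.lt_or_ge k 2 with hk2 | hk2
  · have hk1 : k = 1 := by omega
    subst hk1
    refine ⟨s, ?_⟩
    simp [Nat.choose_one_right]; ring
  · obtain ⟨j, rfl⟩ := Nat.exists_eq_add_of_le hk2
    refine ⟨(p : ℤ_[p]) ^ j * s ^ (2 + j) * (p.choose (2 + j) : ℤ_[p]), ?_⟩
    ring

/-- Fermat: for a unit `x ∈ ℤ_[p]`, `p ∣ x^{p−1} − 1`. [folklore] -/
private theorem p_dvd_pow_sub_one_of_isUnit {x : ℤ_[p]} (hx : IsUnit x) :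
    (p : ℤ_[p]) ∣ x ^ (p - 1) - 1 := by
  have hx0 : toZMod x ≠ 0 := (hx.map (toZMod (p := p))).ne_zero
  have h1 : toZMod (x ^ (p - 1) - 1) = 0 := by
    rw [map_sub, map_pow, map_one, ZMod.pow_card_sub_one_eq_one hx0, sub_self]
  have h2 : x ^ (p - 1) - 1 ∈ RingHom.ker (toZMod (p := p)) := h1
  rw [ker_toZMod, maximalIdeal_eq_span_p, Ideal.mem_span_singleton] at h2
  exact h2

/-- **If `u = x^p` is a unit then `p² ∣ u^{p−1} − 1`**: `x^{p−1} = 1 + p s` (Fermat) and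
`u^{p−1} = (1 + p s)^p ≡ 1 (mod p²)`. [cite: Serre1973, Ch. II §3.2, Lemma and Prop. 8] -/
theorem sq_dvd_pow_sub_one_sub_one_of_pow_eq {u x : ℤ_[p]} (hu : IsUnit u) (hx : x ^ p = u) :
    (p : ℤ_[p]) ^ 2 ∣ u ^ (p - 1) - 1 := by
  have hxu : IsUnit x := by
    rw [← hx] at hu
    exact (isUnit_pow_iff hp.out.ne_zero).mp hu
  obtain ⟨s, hs⟩ := p_dvd_pow_sub_one_of_isUnit hxu
  have hx1 : x ^ (p - 1) = 1 + (p : ℤ_[p]) * s := by linear_combination hs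
  have : u ^ (p - 1) = (1 + (p : ℤ_[p]) * s) ^ p := by
    rw [← hx, ← pow_mul, mul_comm, pow_mul, hx1]
  rw [this]
  exact sq_dvd_one_add_pow_sub_one s

/-- **The `p`-th power criterion in `ℤ_pˣ`, `p` odd** (Serre, *A Course in Arithmetic* II §3:
`U = V × U₁`, `U₁^p = U₂`): a unit `u ∈ ℤ_[p]` is a `p`-th power iff `u^{p−1} ≡ 1 (mod p²)`.
(`⇐`: `w = u^{p−1} ∈ U₂` is a `p`-th power `y^p` by `exists_pow_prime_eq_of_sq_dvd_sub_one`, and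
`u = u^p / u^{p−1} = (u/y)^p`.) At `p = 5`: `u ∈ (ℤ₅ˣ)⁵ ⟺ u⁴ ≡ 1 (mod 25) ⟺ u ≡ ±1, ±7 (mod 25)`.
[cite: Serre1973, Ch. II §3.1 Prop. 7, §3.2 Prop. 8] -/
theorem exists_pow_prime_eq_iff (hp2 : p ≠ 2) {u : ℤ_[p]} (hu : IsUnit u) :
    (∃ x : ℤ_[p], x ^ p = u) ↔ (p : ℤ_[p]) ^ 2 ∣ u ^ (p - 1) - 1 := by
  refine ⟨fun ⟨x, hx⟩ ↦ sq_dvd_pow_sub_one_sub_one_of_pow_eq hu hx, fun h ↦ ?_⟩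
  obtain ⟨y, hy⟩ := exists_pow_prime_eq_of_sq_dvd_sub_one hp2 h
  have hw : IsUnit (u ^ (p - 1)) := hu.pow _
  have hyu : IsUnit y := by
    rw [← hy] at hw
    exact (isUnit_pow_iff hp.out.ne_zero).mp hw
  obtain ⟨yu, rfl⟩ := hyu
  refine ⟨u * ↑yu⁻¹, ?_⟩
  have h1 : (u * ↑yu⁻¹) ^ p * (yu : ℤ_[p]) ^ p = u ^ p := by
    rw [← mul_pow, mul_assoc, Units.inv_mul, mul_one]
  have h2 : u * (yu : ℤ_[p]) ^ p = u ^ p := by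
    rw [hy, ← pow_succ', Nat.sub_add_cancel hp.out.one_le]
  exact mul_right_cancel₀ (pow_ne_zero _ yu.ne_zero) (h1.trans h2.symm)

/-- The `⇐` direction of `exists_pow_prime_eq_iff` as a standalone statement.
[cite: Serre1973, Ch. II §3.2 Prop. 8] -/
theorem exists_pow_prime_eq_of_sq_dvd_sub_one' (hp2 : p ≠ 2) {u : ℤ_[p]} (hu : IsUnit u)
    (h : (p : ℤ_[p]) ^ 2 ∣ u ^ (p - 1) - 1) : ∃ x : ℤ_[p], x ^ p = u :=
  (exists_pow_prime_eq_iff hp2 hu).mpr h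

end PadicInt

/-! ### In `ℚ_p^×`: valuation divisible by `p` and the unit criterion -/

namespace Padic

variable {p : ℕ} [hp : Fact p.Prime]

/-- **`p`-th powers in `ℚ_pˣ`, `p` odd**: for `q = p^k · u` with `u ∈ ℤ_pˣ`, `q` is a `p`-th power
in `ℚ_p` iff `p ∣ k` and `u^{p−1} ≡ 1 (mod p²)` (`ℚ_pˣ = p^ℤ × V × U₁`, Serre II §3.3, with
`PadicInt.exists_pow_prime_eq_iff` on the unit part). At `p = 5` with `q = q_E` the Tate parameter:
`E(ℚ₅)[5] ≠ 0 ⟺ 5 ∣ ord₅ q_E ∧ (q_E/5^k)⁴ ≡ 1 (mod 25)` via the tree's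
`prime_torsion_ne_zero_iff_exists_pow_eq_tateParameter`.
[cite: Serre1973, Ch. II §3.1 Prop. 7, §3.2 Prop. 8, §3.3] -/
theorem exists_pow_prime_eq_iff_of_eq_pow_mul (hp2 : p ≠ 2) {q : ℚ_[p]} {k : ℕ} {u : ℤ_[p]}
    (hu : IsUnit u) (hq : q = (p : ℚ_[p]) ^ k * (u : ℚ_[p])) :
    (∃ x : ℚ_[p], x ^ p = q) ↔ p ∣ k ∧ (p : ℤ_[p]) ^ 2 ∣ u ^ (p - 1) - 1 := by
  have hp1 : (1 : ℝ) < p := by exact_mod_cast hp.out.one_lt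
  have hp0 : (0 : ℝ) < p := by positivity
  have hpQ : (p : ℚ_[p]) ≠ 0 := by exact_mod_cast hp.out.ne_zero
  have hu1 : ‖(u : ℚ_[p])‖ = 1 := by
    rw [PadicInt.padic_norm_e_of_padicInt]; exact PadicInt.isUnit_iff.mp hu
  have hu0 : (u : ℚ_[p]) ≠ 0 := norm_pos_iff.mp (by rw [hu1]; exact one_pos)
  subst hq
  constructor
  · rintro ⟨x, hx⟩
    have hx0 : x ≠ 0 := by
      rintro rfl
      rw [zero_pow hp.out.ne_zero] at hx
      exact (mul_ne_zero (pow_ne_zero _ hpQ) hu0) hx.symm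
    -- valuations: `p · v(x) = k`
    have hnx : ‖x‖ ^ p = (p : ℝ) ^ (-(k : ℤ)) := by
      rw [← norm_pow, hx, norm_mul, Padic.norm_p_pow, hu1, mul_one]
    rw [Padic.norm_eq_zpow_neg_valuation hx0, ← zpow_natCast, ← zpow_mul] at hnx
    have hval : -x.valuation * (p : ℤ) = -(k : ℤ) := zpow_right_injective₀ hp0 hp1.ne' hnx
    have hk : (k : ℤ) = p * x.valuation := by linarith
    have hdvd : p ∣ k := by
      have : (p : ℤ) ∣ (k : ℤ) := ⟨x.valuation, hk⟩
      exact_mod_cast this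
    refine ⟨hdvd, ?_⟩
    obtain ⟨m, hm⟩ := hdvd
    -- `y = x / p^m` is a unit of `ℤ_p` with `y^p = u`
    set y : ℚ_[p] := x * ((p : ℚ_[p]) ^ m)⁻¹ with hy
    have hyp : y ^ p = u := by
      rw [hy, mul_pow, inv_pow, ← pow_mul, hx, hm, mul_comm m p]
      field_simp
    have hy1 : ‖y‖ = 1 := by
      have h := congrArg (‖·‖) hyp
      simp only [norm_pow, hu1] at h
      exact (pow_eq_one_iff_of_nonneg (norm_nonneg _) hp.out.ne_zero).mp h
    set Y : ℤ_[p] := ⟨y, hy1.le⟩ with hY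
    have hYp : Y ^ p = u := by
      apply Subtype.ext
      rw [PadicInt.coe_pow]
      exact hyp
    exact PadicInt.sq_dvd_pow_sub_one_sub_one_of_pow_eq hu hYp
  · rintro ⟨⟨m, rfl⟩, h⟩
    obtain ⟨y, hy⟩ := PadicInt.exists_pow_prime_eq_of_sq_dvd_sub_one' hp2 hu h
    refine ⟨(p : ℚ_[p]) ^ m * (y : ℚ_[p]), ?_⟩
    rw [mul_pow, ← pow_mul, ← PadicInt.coe_pow, hy, mul_comm m p]

end Padic

end
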